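/-
Copyright (c) 2026. All rights reserved.
Released under Apache 2.0 license as described in the file LICENSE.
Authors: abc-iut cell, wave-2 prover seat abc-iut-L6-t6 (pool D-η item D-η-2; proof-only companion of
abc-iut-L1-t5's `DivisorialDescriptions.lean`).
-/
import Literature.AlgebraicGeometry.Frobenioids.DivisorialDescriptions
import Literature.AlgebraicGeometry.Frobenioids.PullbackLinear
import Literature.AlgebraicGeometry.Frobenioids.PullbackLinearSquares
import HarnessLib

/-!
# Frobenioids I, Theorem 5.1 (ii) from Theorem 5.1 (i) (proof-only companion)

Mochizuki, *The geometry of Frobenioids I: the general theory*, Kyushu J. Math. **62** (2008),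
Theorem 5.1, kurims text pp. 96–97, proof p. 99 [cite: MochizukiFrdI2008, Thm. 5.1 (ii) p.97]. The
printed proof of part (ii) is the single sentence "Now assertion (ii) follows formally from assertion
(i) [cf. also Remark 1.1.1; the factorization of Definition 1.3, (iv), (a); the faithfulness portion of
Proposition 3.3, (iv)]" (p. 99). This file supplies that derivation for the typed statements of
abc-iut-L1-t5's `DivisorialDescriptions.lean`: from `Thm51i_bijection F Ψ A` and
`Thm51i_frobenius F Ψ A` (Theorem 5.1 (i) for the ONE Frobenius-trivial object `A` — part (i) for `A'`
is not needed) we prove `Thm51ii_exists_iff F Ψ A A'`, for every subfunctor of groups `Ψ ⊆ Φ^gp`, and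
in particular `Thm51i F A → Thm51ii F A A'` for `Ψ = Φ^birat` (the statement of the text). The
"Moreover" (uniqueness) clause of (ii) is `thm51ii_unique` in the parent file.

Route (over the Frobenioid axioms of Def. 1.3 and the §1 propositions in the tree): `A`-pairs
representing `(B, λ)` may be NORMALIZED to end at `B` (`APair.exists_normalized`), and composing with a
pre-step `β` multiplies the class by the transport of `Div(β)` (`APair.cls_comp_snd`, Rmk. 1.1.1);
RIGIDITY from (i) (the argument printed for (iii), p. 99): an object over `A_D` with a base-identity
endomorphism of Frobenius type of degree `2` is isomorphic to `(A, id)`, its class `ξ` having `2ξ = ξ`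
(`exists_iso_of_frobeniusType_endo`; such endomorphisms live on the domain of every pull-back morphism
into a Frobenius-trivial object, Prop. 1.11 (iii) / Rmk. 1.11.1); COMPATIBILITY of the bijection of (i)
with pull-back morphisms (`exists_apair_of_isPullbackMorphism`: a pull-back morphism `Y → B'` over
`(λ')⁻¹ ∘ θ ∘ ζ` makes `(Y, ζ)` representable by an `A`-pair of class `Φ(θ)(class of (B', λ'))`, via the
square of Prop. 1.11 (v), the factorization "linear = pull-back ∘ pre-step" of Prop. 1.7 (iii), and
rigidity). Then `⇒` factors `φ = α ∘ β ∘ γ` (Def. 1.3 (iv)(a)): the three factors change the class by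
`d ·`, `+ z|_{A_D}`, `Φ(θ)`; `⇐` builds `γ` (Def. 1.3 (ii)), `β` with the prescribed divisor ((iii)(d)), a
pull-back morphism into `B'` over `θ` ((i)(c)), and glues by (i) (equal classes ⇒ isomorphic over `A_D`).

No new definitions. [FrdI] is a refereed 2008 paper; nothing here bears on the disputed IUT claims.
-/

namespace Literature.AlgebraicGeometry.Frobenioids

open CategoryTheory Opposite

namespace PreFrobenioid

universe w v v' u u'

variable {D : Type u} [Category.{v} D] {Φ : Dᵒᵖ ⥤ CommMonCat.{w}}
  {C : Type u'} [Category.{v'} C] {F : C ⥤ ElemFrobenioid Φ}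

/-! ## Normalized `A`-pairs -/

/-- An `A`-pair `(f : S → A, s : S → B)` whose base isomorphism `Base(f) ∘ Base(s)⁻¹` IS `λ`
represents `(B, λ)` in `Pic_C(A)`. [cite: MochizukiFrdI2008, Thm. 5.1 (ii) p.97] -/
theorem APair.mk_toIsomOver_eq {A : C} (X : IsomOver F (baseObj F A)) {S : C} (f : S ⟶ A)
    (s : S ⟶ X.obj) (hf : IsPreStep F f) (hs : IsPreStep F s)
    (h : Base F f = Base F s ≫ X.iso.hom) :
    (⟦(⟨S, X.obj, f, s, hf, hs⟩ : APair F A).toIsomOver⟧ : PicC F (baseObj F A)) = ⟦X⟧ := by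
  apply Quotient.sound
  refine ⟨Iso.refl _, ?_⟩
  haveI : IsIso (Base F s) := hs.2
  haveI : IsIso (Base F f) := hf.2
  change Base F (𝟙 X.obj) ≫ X.iso.hom = inv (Base F s) ≫ Base F f
  rw [base_id, Category.id_comp, h, IsIso.inv_hom_id_assoc]

/-- Every `A`-pair representing `(B, λ)` can be NORMALIZED: composing its second pre-step with the
isomorphism onto `B` gives an `A`-pair `(f : S → A, s : S → B)` with `Base(f) = λ ∘ Base(s)` and the
same class in `Φ^gp(A)`. [cite: MochizukiFrdI2008, Thm. 5.1 (ii) p.97] -/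
theorem APair.exists_normalized (hP : IsPreFrobenioid Φ F) {A : C} (X : IsomOver F (baseObj F A))
    (q : APair F A) (hq : (⟦q.toIsomOver⟧ : PicC F (baseObj F A)) = ⟦X⟧) :
    ∃ (s : q.src ⟶ X.obj) (hs : IsPreStep F s), Base F q.fst = Base F s ≫ X.iso.hom ∧
      (⟨q.src, X.obj, q.fst, s, q.isPreStep_fst, hs⟩ : APair F A).cls = q.cls := by
  haveI : IsIso (Base F q.snd) := q.isPreStep_snd.2
  haveI : IsIso (Base F q.fst) := q.isPreStep_fst.2
  obtain ⟨κ, hκ'⟩ : ∃ κ : q.tgt ≅ X.obj,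
      Base F κ.hom ≫ X.iso.hom = inv (Base F q.snd) ≫ Base F q.fst := Quotient.exact hq
  refine ⟨q.snd ≫ κ.hom, IsPreStep.comp F q.isPreStep_snd (isPreStep_of_isIso F κ.hom), ?_, ?_⟩
  · rw [base_comp, Category.assoc, hκ', IsIso.hom_inv_id_assoc]
  · have hdiv : Div F (q.snd ≫ κ.hom) = Div F q.snd := by
      rw [div_comp, show Div F κ.hom = 1 from isIsometry_of_isIso F hP κ.hom, map_one, one_mul,
        show degFr F κ.hom = 1 from isLinear_of_isIso F κ.hom, PNat.one_coe, pow_one]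
    unfold APair.cls
    simp only [hdiv]

/-- The class in `Φ^gp(A)` of an `A`-pair `(f, s ≫ β)` obtained by composing the second pre-step with
a further pre-step `β`: it is the class of `(f, s)` times the transport `Φ(λ)⁻¹(Div β)` of `Div(β)`
(Remark 1.1.1), where `λ = Base(f) ∘ Base(s)⁻¹`. [cite: MochizukiFrdI2008, Thm. 5.1 (ii) p.97] -/
theorem APair.cls_comp_snd {A : C} (X : IsomOver F (baseObj F A)) {S Y : C}
    (f : S ⟶ A) (s : S ⟶ X.obj) (hf : IsPreStep F f) (hs : IsPreStep F s)
    (h : Base F f = Base F s ≫ X.iso.hom) (β : X.obj ⟶ Y) (hβ : IsPreStep F β) :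
    (⟨S, (X.pushforward β hβ.2).obj, f, s ≫ β, hf, IsPreStep.comp F hs hβ⟩ : APair F A).cls =
      (⟨S, X.obj, f, s, hf, hs⟩ : APair F A).cls *
        Algebra.GrothendieckGroup.of (pull Φ X.iso.inv (Div F β)) := by
  haveI : IsIso (Base F s) := hs.2
  haveI : IsIso (Base F f) := hf.2
  have hinv : inv (Base F f) ≫ Base F s = X.iso.inv := by
    rw [IsIso.inv_comp_eq, h, Category.assoc, Iso.hom_inv_id, Category.comp_id]
  have hdiv : Div F (s ≫ β) = pull Φ (Base F s) (Div F β) * Div F s := by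
    rw [div_comp, show degFr F β = 1 from hβ.1, PNat.one_coe, pow_one]
  unfold APair.cls
  change Algebra.GrothendieckGroup.of (pull Φ (inv (Base F f)) (Div F (s ≫ β))) /
      Algebra.GrothendieckGroup.of (pull Φ (inv (Base F f)) (Div F f)) =
    Algebra.GrothendieckGroup.of (pull Φ (inv (Base F f)) (Div F s)) /
        Algebra.GrothendieckGroup.of (pull Φ (inv (Base F f)) (Div F f)) *
      Algebra.GrothendieckGroup.of (pull Φ X.iso.inv (Div F β))
  rw [hdiv, map_mul, ← pull_comp, hinv, map_mul,
    mul_comm (Algebra.GrothendieckGroup.of (pull Φ X.iso.inv (Div F β))), mul_div_right_comm]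

/-! ## Lifting Frobenius endomorphisms along pull-back morphisms (Prop. 1.11 (iii), Rmk. 1.11.1) -/

/-- The domain of a pull-back morphism into a Frobenius-trivial object carries base-identity
endomorphisms of Frobenius type of every Frobenius degree (lift `ζ_{A'}(n)` along the pull-back
morphism, [FrdI] Prop. 1.11 (iii) and Remark 1.11.1). [cite: MochizukiFrdI2008, Thm. 5.1 (ii) p.97] -/
theorem exists_frobeniusType_endo_of_isPullbackMorphism (hF : IsFrobenioid F) {W A' : C}
    (τ : W ⟶ A') (hτ : IsPullbackMorphism F τ) (hA' : IsFrobeniusTrivial F A') (n : ℕ+) :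
    ∃ κ : W ⟶ W, IsFrobeniusType F κ ∧ Base F κ = 𝟙 _ ∧ degFr F κ = n := by
  obtain ⟨ζ, hζ⟩ := hA'
  obtain ⟨hdeg, hbid, hft⟩ := hζ n
  obtain ⟨κ, ⟨hκb, hsq⟩, -⟩ := existsUnique_endo_lift hτ (show A' ⟶ A' from ζ n) (𝟙 _) (by
    rw [show Base F (show A' ⟶ A' from ζ n) = 𝟙 _ from hbid, Category.comp_id, Category.id_comp])
  have hκiso : IsIso (Base F κ) := by rw [hκb]; infer_instance
  refine ⟨κ, isFrobeniusType_endo_lift hF hτ hft hsq hκiso, hκb, ?_⟩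
  have hd := congrArg (degFr F) hsq
  rw [degFr_comp, degFr_comp, show degFr F τ = 1 from (hF.iv_b τ hτ).2, one_mul, mul_one] at hd
  rw [← hd]
  exact hdeg

/-! ## Rigidity of Frobenius-trivial objects, from Theorem 5.1 (i) (the argument of (iii), p. 99) -/

section WithPsi

variable (Ψ : GpSubfunctor Φ)

/-- From Theorem 5.1 (i) for `A`: an object `(W, e)` over `A_D` admitting a base-identity endomorphism
`κ` of Frobenius type of Frobenius degree `2` is isomorphic to `(A, id)` over `A_D` — its class `ξ` in
`Pic_Φ(A)` satisfies `2 · ξ = ξ`, hence `ξ = 0`, the class of the `A`-pair `(id_A, id_A)` ([FrdI] proof of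
Thm. 5.1 (iii), p. 99 ll. 30–36). [cite: MochizukiFrdI2008, Thm. 5.1 (ii) p.97] -/
theorem exists_iso_of_frobeniusType_endo (hF : IsFrobenioid F) (hiso : IsOfIsotropicType F) {A : C}
    (hA : IsFrobeniusTrivial F A) (hi : Thm51i_bijection F Ψ A) (hifr : Thm51i_frobenius F Ψ A)
    (W : IsomOver F (baseObj F A)) (κ : W.obj ⟶ W.obj) (hκ : IsFrobeniusType F κ)
    (hκb : Base F κ = 𝟙 _) (hκd : degFr F κ = 2) :
    ∃ ι : W.obj ≅ A, Base F ι.hom = W.iso.hom := by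
  obtain ⟨hbij, -, hsurj⟩ := hi hF hiso hA
  obtain ⟨q, hq⟩ := hsurj ⟦W⟧
  haveI : IsIso (Base F κ) := hκ.2
  -- `q` also represents the pushforward of `(W, e)` along `κ` (its base is the identity)
  have hq' : (⟦q.toIsomOver⟧ : PicC F (baseObj F A)) = ⟦W.pushforward κ hκ.2⟧ := by
    rw [hq]
    apply Quotient.sound
    refine ⟨Iso.refl _, ?_⟩
    have hinv : inv (Base F κ) = 𝟙 _ := by
      apply IsIso.inv_eq_of_hom_inv_id
      rw [hκb, Category.comp_id]
    change Base F (𝟙 W.obj) ≫ (inv (Base F κ) ≫ W.iso.hom) = W.iso.hom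
    rw [base_id, Category.id_comp, hinv, Category.id_comp]
  -- so its class `ξ` satisfies `ξ = ξ ^ 2`, i.e. `ξ = 1`
  have h2 := hifr hF hiso hA W κ hκ q q hq hq'
  rw [hκd, show ((2 : ℕ+) : ℕ) = 2 from rfl, pow_two] at h2
  have hone : (QuotientGroup.mk q.cls : Ψ.Pic (baseObj F A)) = 1 :=
    (mul_left_cancel (a := (QuotientGroup.mk q.cls : Ψ.Pic (baseObj F A)))
      (by rw [mul_one]; exact h2)).symm
  -- the trivial `A`-pair `(id_A, id_A)` represents `(A, id)` and has class `1`
  let XA : IsomOver F (baseObj F A) := ⟨A, Iso.refl _⟩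
  let q₀ : APair F A := ⟨A, XA.obj, 𝟙 A, 𝟙 A, isPreStep_of_isIso F (𝟙 A), isPreStep_of_isIso F (𝟙 A)⟩
  have hq₀ : (⟦q₀.toIsomOver⟧ : PicC F (baseObj F A)) = ⟦XA⟧ :=
    APair.mk_toIsomOver_eq XA (𝟙 A) (𝟙 A) _ _ (by
      change Base F (𝟙 A) = Base F (𝟙 A) ≫ 𝟙 _
      rw [Category.comp_id])
  have hq₀cls : (QuotientGroup.mk q₀.cls : Ψ.Pic (baseObj F A)) = 1 := by
    have : q₀.cls = 1 := by
      unfold APair.cls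
      exact div_self' _
    rw [this, QuotientGroup.mk_one]
  have heq : (⟦q.toIsomOver⟧ : PicC F (baseObj F A)) = ⟦q₀.toIsomOver⟧ :=
    (hbij q q₀).mp (hone.trans hq₀cls.symm)
  rw [hq, hq₀] at heq
  obtain ⟨ι, hι⟩ := Quotient.exact heq
  exact ⟨ι, by rw [← hι]; exact (Category.comp_id _).symm⟩

/-! ## Compatibility of the bijection of (i) with pull-back morphisms -/

/-- **Key step** ("assertion (ii) follows formally from assertion (i)", [FrdI] p. 99): if
`α : Y → B'` is a pull-back morphism lying over `(λ')⁻¹ ∘ θ ∘ ζ` with `(Y, ζ) ∈ Ob(C ×_D D^isom_{A_D})`,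
`(B', λ') ∈ Ob(C ×_D D^isom_{A'_D})`, and `(f' : S' → A', s' : S' → B')` is an `A'`-pair representing
`(B', λ')`, then `(Y, ζ)` is represented by an `A`-pair whose class in `Φ^gp(A)` is EXACTLY `Φ(θ)`
applied to the class of `(f', s')`. Construction: pull `s'` back along `α` (Prop. 1.11 (v): a square
`s' ∘ ψ = α ∘ α₀` with `α₀` a co-angular pre-step and `ψ` a pull-back morphism), factor the linear
morphism `f' ∘ ψ = τ ∘ f₁` (pre-step followed by pull-back morphism, Prop. 1.7 (iii)), and identify
the codomain of `f₁` with `A` by the rigidity of Frobenius-trivial objects (Thm. 5.1 (i)/(iii)). [cite: MochizukiFrdI2008, Thm. 5.1 (ii) p.97] -/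
theorem exists_apair_of_isPullbackMorphism (hF : IsFrobenioid F) (hiso : IsOfIsotropicType F)
    {A A' : C} (hA : IsFrobeniusTrivial F A) (hA' : IsFrobeniusTrivial F A')
    (hi : Thm51i_bijection F Ψ A) (hifr : Thm51i_frobenius F Ψ A)
    (X' : IsomOver F (baseObj F A')) (p' : APair F A')
    (hp' : (⟦p'.toIsomOver⟧ : PicC F (baseObj F A')) = ⟦X'⟧)
    (Y : IsomOver F (baseObj F A)) (α : Y.obj ⟶ X'.obj) (hα : IsPullbackMorphism F α)
    (θ : baseObj F A ⟶ baseObj F A') (hαb : Base F α = Y.iso.hom ≫ θ ≫ X'.iso.inv) :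
    ∃ (S : C) (f : S ⟶ A) (s : S ⟶ Y.obj) (hf : IsPreStep F f) (hs : IsPreStep F s),
      Base F f = Base F s ≫ Y.iso.hom ∧
        (⟨S, Y.obj, f, s, hf, hs⟩ : APair F A).cls = pullGp Φ θ p'.cls := by
  have hP : IsPreFrobenioid Φ F := hF.isPreFrobenioid
  have hco : ∀ {X₁ X₂ : C} (g : X₁ ⟶ X₂), IsPreStep F g → IsCoAngularPreStep F g := fun g hg =>
    ⟨isCoAngular_of_isIsotropic_codomains F g (fun _ _ => hiso _), hg⟩
  -- normalize the `A'`-pair: `(f' : S' → A', s' : S' → B')` with `Base f' = Base s' ≫ λ'`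
  obtain ⟨s', hs', hb', hcls'⟩ := APair.exists_normalized hP X' p' hp'
  haveI : IsIso (Base F s') := hs'.2
  haveI : IsIso (Base F p'.fst) := p'.isPreStep_fst.2
  have hinv' : inv (Base F p'.fst) ≫ Base F s' = X'.iso.inv := by
    rw [IsIso.inv_comp_eq, hb', Category.assoc, Iso.hom_inv_id, Category.comp_id]
  obtain ⟨S, α₀, h₀, hdiv₀⟩ := hF.iii_d_over_surj Y.obj (pull Φ (Base F α) (invDiv F s' hs'.2))
  obtain ⟨ψ, hψ, hsq⟩ := exists_pullback_square_over hF hα α₀ s' h₀ (hco s' hs') hdiv₀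
  haveI : IsIso (Base F α₀) := h₀.2.2
  obtain ⟨⟨-, hψiso⟩, hψlin⟩ := hF.iv_b ψ hψ
  obtain ⟨⟨-, hαiso⟩, hαlin⟩ := hF.iv_b α hα
  -- factor the linear morphism `ψ ≫ f'` as pre-step followed by pull-back morphism
  have hlin : IsLinear F (ψ ≫ p'.fst) := IsLinear.comp F hψlin p'.isPreStep_fst.1
  obtain ⟨A₁, f₁, τ, hfac, hf₁, hτ⟩ := (isLinear_iff_exists_preStep_pullback F hF _).mp hlin
  haveI : IsIso (Base F f₁) := hf₁.2
  obtain ⟨⟨-, hτiso⟩, hτlin⟩ := hF.iv_b τ hτ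
  -- rigidity: `A₁ ≅ A` over `e : A₁_D ⥲ A_D`, `e := ζ ∘ Base(α₀) ∘ Base(f₁)⁻¹`
  obtain ⟨κ, hκ, hκb, hκd⟩ := exists_frobeniusType_endo_of_isPullbackMorphism hF τ hτ hA' 2
  let W : IsomOver F (baseObj F A) :=
    ⟨A₁, (asIso (Base F f₁)).symm ≪≫ asIso (Base F α₀) ≪≫ Y.iso⟩
  obtain ⟨ι, hι⟩ := exists_iso_of_frobeniusType_endo Ψ hF hiso hA hi hifr W κ hκ hκb hκd
  have hι' : Base F ι.hom = inv (Base F f₁) ≫ Base F α₀ ≫ Y.iso.hom := hι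
  have hbase : Base F (f₁ ≫ ι.hom) = Base F α₀ ≫ Y.iso.hom := by
    rw [base_comp, hι', IsIso.hom_inv_id_assoc]
  refine ⟨S, f₁ ≫ ι.hom, α₀, IsPreStep.comp F hf₁ (isPreStep_of_isIso F ι.hom), h₀.2, hbase, ?_⟩
  -- zero divisors along the two squares (Remark 1.1.1)
  have hDivα₀ : Div F α₀ = pull Φ (Base F ψ) (Div F s') := by
    have h := congrArg (Div F) hsq
    rw [div_comp, div_comp, show Div F α = 1 from hαiso, map_one, one_mul,
      show degFr F α = 1 from hαlin, PNat.one_coe, pow_one, show Div F ψ = 1 from hψiso, one_pow,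
      mul_one] at h
    exact h.symm
  have hDivf₁ : Div F f₁ = pull Φ (Base F ψ) (Div F p'.fst) := by
    have h := congrArg (Div F) hfac
    rw [div_comp, div_comp, show Div F τ = 1 from hτiso, map_one, one_mul,
      show degFr F τ = 1 from hτlin, PNat.one_coe, pow_one, show Div F ψ = 1 from hψiso, one_pow,
      mul_one] at h
    exact h
  have hDivf : Div F (f₁ ≫ ι.hom) = Div F f₁ := by
    rw [div_comp, show Div F ι.hom = 1 from isIsometry_of_isIso F hP ι.hom, map_one, one_mul,
      show degFr F ι.hom = 1 from isLinear_of_isIso F ι.hom, PNat.one_coe, pow_one]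
  -- bases along the square: `Base ψ = Base α₀ ≫ ζ ≫ θ ≫ Base(f')⁻¹`
  have hBaseψ : Base F ψ = Base F α₀ ≫ Y.iso.hom ≫ θ ≫ inv (Base F p'.fst) := by
    have h := congrArg (Base F) hsq
    rw [base_comp, base_comp, hαb, ← hinv'] at h
    exact (cancel_mono (Base F s')).mp (by simpa only [Category.assoc] using h)
  haveI : IsIso (Base F (f₁ ≫ ι.hom)) := (IsPreStep.comp F hf₁ (isPreStep_of_isIso F ι.hom)).2
  have hinvf : inv (Base F (f₁ ≫ ι.hom)) = Y.iso.inv ≫ inv (Base F α₀) := by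
    apply IsIso.inv_eq_of_hom_inv_id
    rw [hbase, Category.assoc, Y.iso.hom_inv_id_assoc, IsIso.hom_inv_id]
  have hkey : inv (Base F (f₁ ≫ ι.hom)) ≫ Base F ψ = θ ≫ inv (Base F p'.fst) := by
    rw [hinvf, hBaseψ, Category.assoc, IsIso.inv_hom_id_assoc, Y.iso.inv_hom_id_assoc]
  rw [← hcls']
  unfold APair.cls
  change Algebra.GrothendieckGroup.of (pull Φ (inv (Base F (f₁ ≫ ι.hom))) (Div F α₀)) /
      Algebra.GrothendieckGroup.of (pull Φ (inv (Base F (f₁ ≫ ι.hom))) (Div F (f₁ ≫ ι.hom))) =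
    pullGp Φ θ (Algebra.GrothendieckGroup.of (pull Φ (inv (Base F p'.fst)) (Div F s')) /
      Algebra.GrothendieckGroup.of (pull Φ (inv (Base F p'.fst)) (Div F p'.fst)))
  rw [map_div, pullGp_of, pullGp_of, hDivα₀, hDivf, hDivf₁, ← pull_comp, ← pull_comp, hkey,
    pull_comp, pull_comp]
  rfl

end WithPsi

section Main

variable (Ψ : GpSubfunctor Φ)

/-- Pushing a normalized `A`-pair forward along a pre-step `β`: base normalization for
`X.pushforward β`. [cite: MochizukiFrdI2008, Thm. 5.1 (ii) p.97] -/
theorem APair.base_comp_snd {A : C} (X : IsomOver F (baseObj F A)) {S Y : C}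
    (f : S ⟶ A) (s : S ⟶ X.obj)
    (h : Base F f = Base F s ≫ X.iso.hom) (β : X.obj ⟶ Y) (hβ : IsPreStep F β) :
    Base F f = Base F (s ≫ β) ≫ (X.pushforward β hβ.2).iso.hom := by
  haveI : IsIso (Base F β) := hβ.2
  rw [h, base_comp, Category.assoc]
  change _ = Base F s ≫ Base F β ≫ inv (Base F β) ≫ X.iso.hom
  rw [IsIso.hom_inv_id_assoc]

/-- **[FrdI] Theorem 5.1 (ii) follows from Theorem 5.1 (i)** ("assertion (ii) follows formally from
assertion (i) [cf. also Remark 1.1.1; the factorization of Definition 1.3, (iv), (a); …]", p. 99),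
for a general subfunctor of groups `Ψ ⊆ Φ^gp` in the rôle of `Φ^birat`: the bijection `Pic_Φ(A) ⥲ Pic_C(A)`
of (i) for `A` together with its compatibility with morphisms of Frobenius type yields the existence
criterion of (ii) for morphisms `B → B'`. [cite: MochizukiFrdI2008, Thm. 5.1 (ii) p.97] -/
theorem thm51ii_exists_iff_of_thm51i {A A' : C} (hi : Thm51i_bijection F Ψ A)
    (hifr : Thm51i_frobenius F Ψ A) : Thm51ii_exists_iff F Ψ A A' := by
  intro hF hiso hA hA' X X' p p' hp hp' d θ z
  have hP : IsPreFrobenioid Φ F := hF.isPreFrobenioid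
  obtain ⟨hbij, -, hsurj⟩ := hi hF hiso hA
  -- an `A`-pair for `B` pushed forward along a Frobenius-type `γ` and then a pre-step `β`
  have push : ∀ {B₁ Yo : C} (γ : X.obj ⟶ B₁) (hγ : IsFrobeniusType F γ) (β : B₁ ⟶ Yo)
      (hβ : IsPreStep F β),
      ∃ (S : C) (f : S ⟶ A) (s : S ⟶ Yo) (hf : IsPreStep F f) (hs : IsPreStep F s),
        Base F f = Base F s ≫ ((X.pushforward γ hγ.2).pushforward β hβ.2).iso.hom ∧
        (QuotientGroup.mk (⟨S, ((X.pushforward γ hγ.2).pushforward β hβ.2).obj, f, s, hf, hs⟩ :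
            APair F A).cls : Ψ.Pic (baseObj F A)) =
          QuotientGroup.mk p.cls ^ (degFr F γ : ℕ) *
            QuotientGroup.mk (Algebra.GrothendieckGroup.of
              (pull Φ X.iso.inv (pull Φ (Base F γ) (Div F β)))) := by
    intro B₁ Yo γ hγ β hβ
    haveI : IsIso (Base F γ) := hγ.2
    obtain ⟨p₁, hp₁⟩ := hsurj ⟦X.pushforward γ hγ.2⟧
    have hcls₁ := hifr hF hiso hA X γ hγ p p₁ hp hp₁
    obtain ⟨s₁, hs₁, hb₁, hcls₁'⟩ := APair.exists_normalized hP (X.pushforward γ hγ.2) p₁ hp₁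
    refine ⟨p₁.src, p₁.fst, s₁ ≫ β, p₁.isPreStep_fst, IsPreStep.comp F hs₁ hβ,
      APair.base_comp_snd _ p₁.fst s₁ hb₁ β hβ, ?_⟩
    have h := APair.cls_comp_snd (X.pushforward γ hγ.2) p₁.fst s₁ p₁.isPreStep_fst hs₁ hb₁ β hβ
    refine (congrArg (fun c => (QuotientGroup.mk c : Ψ.Pic (baseObj F A))) h).trans ?_
    rw [QuotientGroup.mk_mul, hcls₁', hcls₁]
    congr 2
    rw [← pull_comp]
    rfl
  constructor
  · rintro ⟨φ, hφd, hφb, hφz⟩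
    obtain ⟨B₁, Yo, γ, β, α, hfac, hγ, hβ, hα⟩ := hF.iv_a_exists φ
    haveI : IsIso (Base F γ) := hγ.2
    haveI : IsIso (Base F β) := hβ.2
    obtain ⟨⟨-, hαiso⟩, hαlin⟩ := hF.iv_b α hα
    -- degrees and divisors along the factorization (Remark 1.1.1)
    have hdeg : degFr F γ = d := by
      have h := congrArg (degFr F) hfac
      rw [degFr_comp, degFr_comp, show degFr F β = 1 from hβ.1, show degFr F α = 1 from hαlin,
        mul_one, mul_one, hφd] at h
      exact h
    have hz : pull Φ (Base F γ) (Div F β) = z := by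
      have h := congrArg (Div F) hfac
      rw [div_comp, div_comp, show Div F α = 1 from hαiso, map_one, one_mul,
        show degFr F α = 1 from hαlin, PNat.one_coe, pow_one, show Div F γ = 1 from hγ.1.2,
        one_pow, mul_one, hφz] at h
      exact h
    -- the pushed-forward pair and the pulled-back pair both represent `(Yo, ζ₂)`
    obtain ⟨S₂, f₂, s₂, hf₂, hs₂, hb₂, hcls₂⟩ := push γ hγ β hβ
    have hαb : Base F α = ((X.pushforward γ hγ.2).pushforward β hβ.2).iso.hom ≫ θ ≫ X'.iso.inv := by
      have h := congrArg (Base F) hfac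
      rw [base_comp, base_comp, hφb] at h
      change Base F α = (inv (Base F β) ≫ inv (Base F γ) ≫ X.iso.hom) ≫ θ ≫ X'.iso.inv
      rw [Category.assoc, Category.assoc, ← h]
      simp
    obtain ⟨S, f, s, hf, hs, hbS, hclsS⟩ := exists_apair_of_isPullbackMorphism Ψ hF hiso hA hA'
      hi hifr X' p' hp' ((X.pushforward γ hγ.2).pushforward β hβ.2) α hα θ hαb
    have heq := (hbij _ _).mpr ((APair.mk_toIsomOver_eq _ f₂ s₂ hf₂ hs₂ hb₂).trans
      (APair.mk_toIsomOver_eq _ f s hf hs hbS).symm)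
    rw [hcls₂, hclsS, hdeg, hz] at heq
    rw [heq]
    rfl
  · intro hrel
    obtain ⟨B₁, γ, hγ, hγd⟩ := hF.ii_exists X.obj d
    haveI : IsIso (Base F γ) := hγ.2
    obtain ⟨Yo, β, hβco, hβz⟩ := hF.iii_d_under_surj B₁ (pull Φ (inv (Base F γ)) z)
    have hβ : IsPreStep F β := hβco.2
    haveI : IsIso (Base F β) := hβ.2
    have hz : pull Φ (Base F γ) (Div F β) = z := by
      rw [hβz, ← pull_comp, IsIso.hom_inv_id, pull_id]
    obtain ⟨S₂, f₂, s₂, hf₂, hs₂, hb₂, hcls₂⟩ := push γ hγ β hβ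
    rw [hγd, hz] at hcls₂
    obtain ⟨Wo, α₁, i, hα₁, hα₁b⟩ := exists_isPullbackMorphism_over hF X'.obj (θ ≫ X'.iso.inv)
    obtain ⟨S, f, s, hf, hs, hbS, hclsS⟩ := exists_apair_of_isPullbackMorphism Ψ hF hiso hA hA'
      hi hifr X' p' hp' ⟨Wo, i⟩ α₁ hα₁ θ hα₁b
    -- the classes agree, so by (i) the objects are isomorphic over `A_D`
    have hcls : (QuotientGroup.mk
        (⟨S₂, ((X.pushforward γ hγ.2).pushforward β hβ.2).obj, f₂, s₂, hf₂, hs₂⟩ : APair F A).cls :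
          Ψ.Pic (baseObj F A)) =
        QuotientGroup.mk (⟨S, (⟨Wo, i⟩ : IsomOver F (baseObj F A)).obj, f, s, hf, hs⟩ :
          APair F A).cls := by
      rw [hcls₂, hclsS, hrel]
      rfl
    have hiso' := ((APair.mk_toIsomOver_eq ((X.pushforward γ hγ.2).pushforward β hβ.2) f₂ s₂ hf₂
      hs₂ hb₂).symm.trans ((hbij _ _).mp hcls)).trans
        (APair.mk_toIsomOver_eq (⟨Wo, i⟩ : IsomOver F (baseObj F A)) f s hf hs hbS)
    obtain ⟨ιY, hιY⟩ : ∃ ιY : Yo ≅ Wo,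
        Base F ιY.hom ≫ i.hom = inv (Base F β) ≫ inv (Base F γ) ≫ X.iso.hom := Quotient.exact hiso'
    obtain ⟨⟨-, hα₁iso⟩, hα₁lin⟩ := hF.iv_b α₁ hα₁
    refine ⟨γ ≫ β ≫ ιY.hom ≫ α₁, ?_, ?_, ?_⟩
    · rw [degFr_comp, degFr_comp, degFr_comp, hγd, show degFr F β = 1 from hβ.1,
        show degFr F ιY.hom = 1 from isLinear_of_isIso F ιY.hom, show degFr F α₁ = 1 from hα₁lin,
        mul_one, mul_one, mul_one]
    · rw [base_comp, base_comp, base_comp, hα₁b, ← Category.assoc (Base F ιY.hom), hιY]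
      simp
    · rw [div_comp, div_comp, div_comp, show Div F α₁ = 1 from hα₁iso, map_one, one_mul,
        show Div F ιY.hom = 1 from isIsometry_of_isIso F hP ιY.hom, one_pow, map_one, one_mul,
        degFr_comp, show degFr F ιY.hom = 1 from isLinear_of_isIso F ιY.hom,
        show degFr F α₁ = 1 from hα₁lin, mul_one, PNat.one_coe, pow_one, hz,
        show Div F γ = 1 from hγ.1.2, one_pow, mul_one]

/-- **[FrdI] Theorem 5.1 (ii)** (`Ψ = Φ^birat`, the statement of the text) **from Theorem 5.1 (i)**. [cite: MochizukiFrdI2008, Thm. 5.1 (ii) p.97] -/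
theorem thm51ii_of_thm51i {A A' : C} (h : Thm51i F A) : Thm51ii F A A' :=
  thm51ii_exists_iff_of_thm51i (biratSubfunctor F) h.1 h.2

end Main

end PreFrobenioid

end Literature.AlgebraicGeometry.Frobenioids
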